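import Literature.Probability.RandomPlanarGeometry.TranslatedHullJets
import HarnessLib

/-!
# `h_t'(O_t) = E_B'(o)` and `(h_t(W_t) − h_t(O_t))/(W_t − O_t) = E_B(o)/o`: the factors of `M_t` through the reflected map

G. F. Lawler, O. Schramm, W. Werner, *Conformal restriction: the chordal case*, J. Amer. Math.
Soc. **16** (2003) 917–955, arXiv:math/0209343 (**[LSW]**), §8.4: the one-sided martingale
`M_t = h_t'(W_t)^{5/8} h_t'(O_t)^b [(h_t(W_t) − h_t(O_t))/(W_t − O_t)]^c` evaluates the map
`h_t = g_{g_t(A)}` and its derivative at the TWO real points `W_t` and `O_t ≤ W_t`. In the slid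
coordinates of the tree (`B = A_t − W_t`, `o = O_t − W_t ≤ 0`, `E_B = starMap B` the Schwarz
reflection of `Φ_B`, `SLEKappaRhoMartingale.oneSidedM`) the three factors are `Φ'_B(0) = E_B'(0)`,
`Φ'_{B−o}(0)` and `hullSlope B o = ⨍_{[o,0]} Φ'_{B−x}(0) dx`. The tree identifies
`Φ'_{B−x}(0) = E_B'(x)` only for `|x| < 4ρ₀` (`starDeriv_translate`, `TranslatedHullJets`: the
local theory of `E_B` near `0`), whereas `o = O_t − W_t` is not small. This file PROVES the
identification at every real point off the hull and rewrites `M` through `E_B`: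

* `im_deriv_starMap_ofReal` — `E_B'(x) ∈ ℝ` at every real `x ∉ B` (`E_B` is holomorphic on the
  symmetric domain `ℂ ∖ (B ∪ B̄)` and real on `ℝ ∖ B`);
* `isRestrictionMap_translateRMap'`, `hasRestrictionDeriv_translateRMap'`, `starDeriv_translate'`,
  `hullDeriv_translate` — for every real `x ∉ B`: `z ↦ Φ_B(z + x) − E_B(x)` is a restriction map
  of `B − x` with derivative `E_B'(x)`, so **`Φ'_{B−x}(0) = E_B'(x)`** (= `h_t'(x + W_t)`);
* `hasDerivAt_re_starMap`, `integral_hullDeriv_translate`, `hullSlope_eq_div` — the real function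
  `x ↦ E_B(x)` has derivative `E_B'(x)` off `B`, hence by the fundamental theorem of calculus
  **`hullSlope B o = E_B(o)/o`** for `o < 0` with `[o, 0] ∩ B = ∅` (= `(h(W) − h(O))/(W − O)`,
  `E_B(0) = 0`);
* `oneSidedM_eq_starMap` — consequently, for such `o`,
  `oneSidedM ρ B o = E_B'(0)^{5/8} · E_B'(o)^b · (E_B(o)/o)^c` (real powers), the form in which
  the one-step expansion of `M` (Lemma 8.9) is a statement about the single holomorphic function
  `E_B`; for `+`-hulls every `o ≤ 0` qualifies (`IsPlusHull.ofReal_notMem_of_nonpos`).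

No definitions, no named facts.

## References

* [LSW] §8.4 (definition of `M_t`), §5 (`h_t`, `h_t'` at real points), §2 p. 8 (`Φ_A`).
  [LawlerSchrammWerner2003Restriction]
-/

noncomputable section

open Set Filter Metric Function Complex Bornology MeasureTheory
open _root_.Topology
open UpperHalfPlane (upperHalfPlaneSet)
open scoped NNReal

namespace Literature.Probability.RandomPlanarGeometry

open Loewner SLEKappaRho

variable {B : Set ℂ}

/-! ### `E_B` and `E_B'` are real at every real point off the hull -/

/-- `E_B(x) ∈ ℝ` for real `x ∉ B`. [folklore] -/
theorem starMap_ofReal_eq_re' (hB : IsStarHull B) {x : ℝ} (hx : (x : ℂ) ∉ B) :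
    starMap B x = ((starMap B x).re : ℂ) := by
  rw [starMap_eq hB]
  have him := hullExt_ofReal_im (Φ := starRMap B hB) hB.isBoundedHull (isRestrictionMap_starRMap hB) hx
  exact Complex.ext (by simp) (by simp [him])

/-- A real point off the (closed) hull has a ball around it inside the symmetric domain
`ℂ ∖ (B ∪ B̄)`. [folklore] -/
theorem exists_ball_subset_symmDomain (hB : IsStarHull B) {x : ℝ} (hx : (x : ℂ) ∉ B) :
    ∃ r : ℝ, 0 < r ∧ ball (x : ℂ) r ⊆ symmDomain B :=
  Metric.isOpen_iff.1 (isOpen_symmDomain hB.isBoundedHull.isClosed) x (ofReal_mem_symmDomain_iff.2 hx)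

/-- **`E_B'(x) ∈ ℝ` at every real `x ∉ B`** (`E_B` is holomorphic near `x` and real on the real
points near `x`). [folklore] -/
theorem im_deriv_starMap_ofReal (hB : IsStarHull B) {x : ℝ} (hx : (x : ℂ) ∉ B) :
    (deriv (starMap B) x).im = 0 := by
  obtain ⟨r, hr, hsub⟩ := exists_ball_subset_symmDomain hB hx
  have hΦ := isRestrictionMap_starRMap hB
  have hE : DifferentiableOn ℂ (starMap B) (symmDomain B) := by
    rw [starMap_eq hB]; exact differentiableOn_hullExt hB.isBoundedHull hΦ
  -- recentre at `x`
  set F : ℂ → ℂ := fun z ↦ starMap B (z + x) with hF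
  have hFd : DifferentiableOn ℂ F (ball (0 : ℂ) r) := by
    refine hE.comp ((differentiable_id.add_const _).differentiableOn) fun z hz ↦ hsub ?_
    rw [mem_ball, dist_eq_norm] at hz ⊢
    simpa using hz
  have hreal : ∀ t : ℝ, |t| < r → (F t).im = 0 := by
    intro t ht
    have hmem : ((t + x : ℝ) : ℂ) ∈ symmDomain B := by
      refine hsub ?_
      rw [mem_ball, dist_eq_norm]
      push_cast
      simpa [Real.norm_eq_abs] using ht
    have hnot : ((t + x : ℝ) : ℂ) ∉ B := (ofReal_mem_symmDomain_iff.1 hmem)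
    have := congrArg Complex.im (starMap_ofReal_eq_re' hB hnot)
    simp only [ofReal_im] at this
    rw [hF]
    push_cast at this ⊢
    exact this
  have h := im_deriv_eq_zero_of_im_eq_zero hFd hreal (x := 0) (by simpa using hr)
  rwa [hF, ofReal_zero, deriv_comp_add_const, zero_add] at h

/-- `E_B'(x)` equals its real part, as a complex number, at real `x ∉ B`. [folklore] -/
theorem deriv_starMap_ofReal_eq_re (hB : IsStarHull B) {x : ℝ} (hx : (x : ℂ) ∉ B) :
    deriv (starMap B) x = ((deriv (starMap B) x).re : ℂ) :=
  Complex.ext (by simp) (by simp [im_deriv_starMap_ofReal hB hx])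

/-! ### `Φ'_{B−x}(0) = E_B'(x)` at every real point off the hull -/

/-- **`translateRMap` is a restriction map of `B − x`** for every real `x ∉ B` (the proof of
`isRestrictionMap_translateRMap` verbatim: only `x ∉ B` is used there).
[cite: LawlerSchrammWerner2003Restriction, §2 p. 8 (Φ_A) with §5] -/
theorem isRestrictionMap_translateRMap' (hB : IsStarHull B) {x : ℝ} (hxB : (x : ℂ) ∉ B) :
    IsRestrictionMap (translate B x) (translateRMap hB x) := by
  have hΦ := isRestrictionMap_starRMap hB
  have hreal := starMap_ofReal_eq_re' hB hxB
  refine ⟨?_, ?_⟩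
  · -- boundary value `0` at `0`
    change Tendsto (fun z ↦ translateRMap hB x z) (𝓝[upperHalfPlaneSet \ translate B x] 0) (𝓝 0)
    simp_rw [translateRMap_apply]
    have h1 := (tendsto_hullExt_ofReal hB.isBoundedHull hΦ hxB).comp (tendsto_add_nhdsWithin_diff_translate x)
    rw [← starMap_eq hB, hreal] at h1
    have h2 := h1.sub_const (((starMap B x).re : ℂ))
    rw [sub_self] at h2
    exact h2
  · -- `Ψ(z)/z → 1` at `∞`
    simp_rw [translateRMap_apply]
    set F := cocompact ℂ ⊓ 𝓟 (upperHalfPlaneSet \ translate B x) with hF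
    have hT := tendsto_add_cocompact_diff_translate (B := B) x
    have h1 : Tendsto (fun z : ℂ ↦ starRMap B hB (z + x) / (z + x)) F (𝓝 1) := hΦ.2.comp hT
    have hinv : Tendsto (fun z : ℂ ↦ z⁻¹) (cocompact ℂ) (𝓝 0) := by
      rw [← cobounded_eq_cocompact]; exact tendsto_inv₀_cobounded
    have hinv' : Tendsto (fun z : ℂ ↦ z⁻¹) F (𝓝 0) := hinv.mono_left inf_le_left
    have h2 : Tendsto (fun z : ℂ ↦ (z + x) / z) F (𝓝 1) := by
      have : Tendsto (fun z : ℂ ↦ 1 + (x : ℂ) * z⁻¹) F (𝓝 (1 + (x : ℂ) * 0)) :=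
        tendsto_const_nhds.add (hinv'.const_mul _)
      rw [mul_zero, add_zero] at this
      refine this.congr' ?_
      have hne : ∀ᶠ z : ℂ in F, z ≠ 0 := by
        filter_upwards [mem_inf_of_right (mem_principal_self _)] with z hz
        rintro rfl
        exact absurd hz.1 (by simp [upperHalfPlaneSet])
      filter_upwards [hne] with z hz
      field_simp
    have h3 : Tendsto (fun z : ℂ ↦ ((starMap B x).re : ℂ) * z⁻¹) F (𝓝 0) := by
      simpa using hinv'.const_mul (((starMap B x).re : ℂ))
    have h4 := (h1.mul h2).sub h3
    rw [mul_one, sub_zero] at h4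
    refine h4.congr' ?_
    have hne : ∀ᶠ z : ℂ in F, z ≠ 0 ∧ z + x ≠ 0 := by
      have hbig : ∀ᶠ z : ℂ in cocompact ℂ, |x| < ‖z‖ := by
        rw [← cobounded_eq_cocompact]
        exact (tendsto_norm_cobounded_atTop.eventually (eventually_gt_atTop |x|))
      filter_upwards [mem_inf_of_left hbig] with z hz
      constructor
      · rintro rfl; simp at hz; linarith [abs_nonneg x]
      · intro h
        have : z = -x := eq_neg_of_add_eq_zero_left h
        rw [this, norm_neg, norm_real, Real.norm_eq_abs] at hz
        exact lt_irrefl _ hz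
    filter_upwards [hne] with z hz
    obtain ⟨hz0, hzx⟩ := hz
    field_simp

/-- **`Φ′_{B−x}(0) = E_B′(x)`** at every real `x ∉ B`: the restriction derivative of the
translate is the (real) derivative of the reflected map at `x`.
[cite: LawlerSchrammWerner2003Restriction, §5 (h_t′ at real points) and §8.4 (h_t′(O_t))] -/
theorem hasRestrictionDeriv_translateRMap' (hB : IsStarHull B) {x : ℝ} (hxB : (x : ℂ) ∉ B) :
    HasRestrictionDeriv (translate B x) (translateRMap hB x) (deriv (starMap B) x).re := by
  have hΦ := isRestrictionMap_starRMap hB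
  have hreal := starMap_ofReal_eq_re' hB hxB
  -- `E_B` is differentiable at `x`
  have hdiff : HasDerivAt (starMap B) (deriv (starMap B) x) x := by
    have : DifferentiableAt ℂ (starMap B) x := by
      rw [starMap_eq hB]
      exact differentiableAt_hullExt hB.isBoundedHull hΦ (ofReal_mem_symmDomain_iff.2 hxB)
    exact this.hasDerivAt
  have hdre : ((deriv (starMap B) x).re : ℂ) = deriv (starMap B) x := (deriv_starMap_ofReal_eq_re hB hxB).symm
  -- the slope of `E_B` at `x`, along `z ↦ z + x`
  have hslope : Tendsto (fun z : ℂ ↦ (starMap B (z + x) - starMap B x) / z) (𝓝[≠] 0)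
      (𝓝 (deriv (starMap B) x)) := by
    have hs := hdiff.tendsto_slope
    have hT : Tendsto (fun z : ℂ ↦ z + x) (𝓝[≠] (0 : ℂ)) (𝓝[≠] (x : ℂ)) := by
      refine tendsto_nhdsWithin_iff.2 ⟨?_, ?_⟩
      · have : Tendsto (fun z : ℂ ↦ z + x) (𝓝 0) (𝓝 ((0 : ℂ) + x)) :=
          (continuous_id.add continuous_const).tendsto 0
        rw [zero_add] at this
        exact this.mono_left nhdsWithin_le_nhds
      · filter_upwards [self_mem_nhdsWithin] with z hz
        simpa using hz
    have := hs.comp hT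
    refine this.congr' (Eventually.of_forall fun z ↦ ?_)
    simp only [Function.comp_apply, slope_def_field, add_sub_cancel_right]
  unfold HasRestrictionDeriv
  rw [hdre]
  have hle : 𝓝[upperHalfPlaneSet \ translate B x] (0 : ℂ) ≤ 𝓝[≠] 0 :=
    nhdsWithin_mono _ fun z hz h0 ↦ absurd hz.1 (by rw [h0]; simp [upperHalfPlaneSet])
  refine (hslope.mono_left hle).congr' ?_
  filter_upwards [self_mem_nhdsWithin] with z hz
  rw [translateRMap_apply, ← hreal, starMap_eq hB, hullExt_of_mem_diff (add_mem_diff_of_mem hz)]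

/-- **`starDeriv (B − x) = E_B′(x)`** for every real `x ∉ B`.
[cite: LawlerSchrammWerner2003Restriction, §5 (h_t′ at real points) and §8.4 (h_t′(O_t))] -/
theorem starDeriv_translate' (hB : IsStarHull B) {x : ℝ} (hxB : (x : ℂ) ∉ B) :
    starDeriv (translate B x) = (deriv (starMap B) x).re := by
  have hBx : IsStarHull (translate B x) := isStarHull_translate hB.isBoundedHull hxB
  exact (HasRestrictionDeriv.eq_starDeriv hBx (isRestrictionMap_translateRMap' hB hxB)
    (hasRestrictionDeriv_translateRMap' hB hxB)).symm

/-- **`hullDeriv (B − x) = E_B′(x)`** (`= Φ'_{B−x}(0) = h_t'(x + W_t)`) for every real `x ∉ B`.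
[cite: LawlerSchrammWerner2003Restriction, §8.4 (h_t′(O_t))] -/
theorem hullDeriv_translate (hB : IsStarHull B) {x : ℝ} (hxB : (x : ℂ) ∉ B) :
    hullDeriv (translate B x) = (deriv (starMap B) x).re := by
  rw [hullDeriv_eq_starDeriv, starDeriv_translate' hB hxB]

/-- In particular `0 < E_B'(x) ≤ 1` at real `x ∉ B` ([LSW] (2.4)).
[cite: LawlerSchrammWerner2003Restriction, §2 (2.4)] -/
theorem re_deriv_starMap_pos_le_one (hB : IsStarHull B) {x : ℝ} (hxB : (x : ℂ) ∉ B) :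
    0 < (deriv (starMap B) x).re ∧ (deriv (starMap B) x).re ≤ 1 := by
  rw [← hullDeriv_translate hB hxB]
  exact ⟨hullDeriv_pos _, hullDeriv_le_one _⟩

/-! ### `x ↦ E_B(x)` on the real axis: derivative and the fundamental theorem of calculus -/

/-- **The real function `x ↦ E_B(x)` has derivative `E_B'(x)` at every real `x ∉ B`.** [folklore] -/
theorem hasDerivAt_re_starMap (hB : IsStarHull B) {x : ℝ} (hxB : (x : ℂ) ∉ B) :
    HasDerivAt (fun y : ℝ ↦ (starMap B y).re) (deriv (starMap B) x).re x := by
  have hΦ := isRestrictionMap_starRMap hB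
  have hdiff : HasDerivAt (starMap B) (deriv (starMap B) x) x := by
    have : DifferentiableAt ℂ (starMap B) x := by
      rw [starMap_eq hB]
      exact differentiableAt_hullExt hB.isBoundedHull hΦ (ofReal_mem_symmDomain_iff.2 hxB)
    exact this.hasDerivAt
  have h1 : HasDerivAt (fun t : ℝ ↦ starMap B t) (deriv (starMap B) x) x := by
    simpa using hdiff.comp_ofReal
  exact Complex.reCLM.hasFDerivAt.comp_hasDerivAt x h1

/-- `x ↦ E_B'(x)` is continuous on the real points off the hull (`E_B` is holomorphic on the open
symmetric domain). [folklore] -/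
theorem continuousOn_re_deriv_starMap (hB : IsStarHull B) :
    ContinuousOn (fun y : ℝ ↦ (deriv (starMap B) y).re) {y : ℝ | (y : ℂ) ∉ B} := by
  have hΦ := isRestrictionMap_starRMap hB
  have hE : DifferentiableOn ℂ (starMap B) (symmDomain B) := by
    rw [starMap_eq hB]; exact differentiableOn_hullExt hB.isBoundedHull hΦ
  have hopen := isOpen_symmDomain hB.isBoundedHull.isClosed
  have hcd : ContinuousOn (deriv (starMap B)) (symmDomain B) :=
    ((hE.analyticOnNhd hopen).deriv).continuousOn
  have hmaps : MapsTo (fun y : ℝ ↦ (y : ℂ)) {y : ℝ | (y : ℂ) ∉ B} (symmDomain B) := fun y hy ↦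
    ofReal_mem_symmDomain_iff.2 hy
  exact Complex.continuous_re.comp_continuousOn ((hcd.comp continuous_ofReal.continuousOn hmaps))

/-- **The fundamental theorem of calculus for `h_t` between `O_t` and `W_t`**: for `o < 0` with
`[o, 0]` off the hull, `∫_o^0 Φ'_{B−y}(0) dy = E_B(0) − E_B(o) = −E_B(o)`.
[cite: LawlerSchrammWerner2003Restriction, §8.4 (the factor (h_t(W_t) − h_t(O_t))/(W_t − O_t))] -/
theorem integral_hullDeriv_translate (hB : IsStarHull B) {o : ℝ} (ho : o < 0)
    (hoff : ∀ y ∈ Icc o 0, ((y : ℝ) : ℂ) ∉ B) :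
    ∫ y in o..0, hullDeriv (translate B y) = -(starMap B o).re := by
  have huIcc : uIcc o 0 = Icc o 0 := uIcc_of_le ho.le
  have h1 : ∫ y in o..0, hullDeriv (translate B y) = ∫ y in o..0, (deriv (starMap B) y).re :=
    intervalIntegral.integral_congr fun y hy ↦ hullDeriv_translate hB (hoff y (huIcc ▸ hy))
  rw [h1, intervalIntegral.integral_eq_sub_of_hasDerivAt (f := fun y : ℝ ↦ (starMap B y).re)]
  · simp [starMap_zero hB]
  · intro y hy
    exact hasDerivAt_re_starMap hB (hoff y (huIcc ▸ hy))
  · refine ContinuousOn.intervalIntegrable ?_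
    rw [huIcc]
    exact (continuousOn_re_deriv_starMap hB).mono fun y hy ↦ hoff y hy

/-- **`(h_t(W_t) − h_t(O_t))/(W_t − O_t) = E_B(o)/o`** in slid coordinates: for `o < 0` with
`[o, 0]` off the hull, `hullSlope B o = E_B(o)/o`.
[cite: LawlerSchrammWerner2003Restriction, §8.4 (the factor (h_t(W_t) − h_t(O_t))/(W_t − O_t))] -/
theorem hullSlope_eq_div (hB : IsStarHull B) {o : ℝ} (ho : o < 0)
    (hoff : ∀ y ∈ Icc o 0, ((y : ℝ) : ℂ) ∉ B) :
    hullSlope B o = (starMap B o).re / o := by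
  rw [hullSlope_of_neg B ho, integral_hullDeriv_translate hB ho hoff, neg_div_neg_eq]

/-- Real points of a `+`-hull are positive, so every `y ≤ 0` is off the hull. [folklore] -/
theorem IsPlusHull.ofReal_notMem_of_nonpos (hB : IsPlusHull B) {y : ℝ} (hy : y ≤ 0) :
    (y : ℂ) ∉ B := fun h ↦ by linarith [hB.2 y h]

/-- **[LSW]'s `M` through the reflected map**: for a `*`-hull `B` and `o < 0` with `[o, 0]` off
`B`, `oneSidedM ρ B o = E_B'(0)^{5/8} · E_B'(o)^b · (E_B(o)/o)^c`, i.e.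
`h'(W)^{5/8} h'(O)^b ((h(W) − h(O))/(W − O))^c` with `h = E_B`, `W = 0`, `O = o`.
[cite: LawlerSchrammWerner2003Restriction, §8.4 (definition of M_t)] -/
theorem oneSidedM_eq_starMap (hB : IsStarHull B) {o : ℝ} (ho : o < 0)
    (hoff : ∀ y ∈ Icc o 0, ((y : ℝ) : ℂ) ∉ B) (ρ : ℝ) :
    oneSidedM ρ B o = starDeriv B ^ (5 / 8 : ℝ) * (deriv (starMap B) o).re ^ expB ρ *
      ((starMap B o).re / o) ^ expC ρ := by
  rw [oneSidedM, hullDeriv_eq_starDeriv, hullDeriv_translate hB (hoff o (left_mem_Icc.2 ho.le)),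
    hullSlope_eq_div hB ho hoff]

/-- The same for a `+`-hull and any `o < 0`. [cite: LawlerSchrammWerner2003Restriction, §8.4 (definition of M_t)] -/
theorem IsPlusHull.oneSidedM_eq_starMap (hB : IsPlusHull B) {o : ℝ} (ho : o < 0) (ρ : ℝ) :
    oneSidedM ρ B o = starDeriv B ^ (5 / 8 : ℝ) * (deriv (starMap B) o).re ^ expB ρ *
      ((starMap B o).re / o) ^ expC ρ :=
  RandomPlanarGeometry.oneSidedM_eq_starMap hB.1 ho (fun _ hy ↦ hB.ofReal_notMem_of_nonpos hy.2) ρ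

/-- And the slope factor alone for a `+`-hull: `hullSlope B o = E_B(o)/o`, `o < 0`. [folklore] -/
theorem IsPlusHull.hullSlope_eq_div (hB : IsPlusHull B) {o : ℝ} (ho : o < 0) :
    hullSlope B o = (starMap B o).re / o :=
  RandomPlanarGeometry.hullSlope_eq_div hB.1 ho fun _ hy ↦ hB.ofReal_notMem_of_nonpos hy.2

end Literature.Probability.RandomPlanarGeometry

end
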